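import Summits.BirchSwinnertonDyer.BirchSwinnertonDyer.Theorems.ErratumRoadFiveAuxNormReceptacleDefs
import Literature.NumberTheory.QuadraticFields.SplitPrimeKummerWitnessOrder
import HarnessLib

/-!
# Route `ErratumRoadFive` (K2, `p ≥ 5`), crux `EulerHalfNotRamNoInertSetAtFive` (item stmt-BirchSwinnertonDyer-19715),
# line `birth` v15 «birth ⊕ aux_norm graft» (LEAD bsd-line-er5-p1 g3): the leaf stub **(O) `stub_splitPrimeKummerWitness`**
# with EXACTLY the v15 header (LEAD g3, HOME STATUS 2026-08-28T15:15:19Z), over the Defs module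
# `Theorems/ErratumRoadFiveAuxNormReceptacleDefs.lean` (p643374)
# (cell `bsd-stepL`, width seat `bsd-line-er5-p1-w4` g8; `--supports stmt-BirchSwinnertonDyer-19715`)

The statement is `AuxNormReceptacle.SplitPrimeKummerWitness K p q` (def, v4 §1 of `Lines/aux_norm_receptacle.lean` byte-identical):
for every exponent `E` there are `γ ∈ 𝓞_K ∖ 0`, `r ∈ ℚ`, a finite bad set `T₀`, with `N(γ) = r^p`, `γ ∉ K^{×p}`, such that for every
prime `ℓ₀ ∉ T₀` inert in `K` with `p^E ∣ ℓ₀ + 1` modulo which `γ` is not a `p`-th power, `p^E ∣ orderOf [𝔭_v]_{ℓ₀}` for every prime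
`v ∋ q` of `K`. PROOF = the Literature theorem `RingClass.exists_splitPrimeKummerWitness`
(`Literature/NumberTheory/QuadraticFields/SplitPrimeKummerWitnessOrder.lean`, with its prequel `SplitPrimeKummerWitness.lean`): witness `γ = (σβ)^{p+1} β^{p-1}` for `𝔮^h = (β)`,
`h = orderOf [𝔮]`, `T₀ = {q}`; `γ ∉ K^{×p}` by `𝔮`-adic multiplicities + unique factorisation of ideals + `[σ𝔮] = [𝔮]^{-1}`
(Cox §7.B); the residue clause by Euler's criterion in `(𝓞_K/ℓ₀)^×` and the prime-conductor order lemma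
`RingClass.pow_dvd_orderOf_primeClass_of_inert` (Cox (7.27); bsd-line-er5-p1-w2 g5, p640886).

HONEST FRAMING. One-line wrapper; theorems only. Nothing here closes 19715; S1 and (C) are separate leaves; no summit statement is
proved by this seat; BSD is proved for no curve. [cite: Cox2013, §7.B, §7.D (7.27)] [cite: GrossLMS1991, §3 (p. 239)]
-/

set_option autoImplicit false
set_option linter.dupNamespace false

noncomputable section

namespace Summit.BirchSwinnertonDyer.BirchSwinnertonDyer.Theorems.AuxNormReceptacle

/-- **Leaf stub (O) of line v15 — the Kummer witness of the split carrier prime, PROVED** (header VERBATIM as fixed by the LEAD):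
for `K` imaginary quadratic with `d_K < -4`, a prime `p ≥ 3` and a rational prime `q` with two primes of `K` above it,
`AuxNormReceptacle.SplitPrimeKummerWitness K p q` (witness `γ = (σβ)^{p+1} β^{p-1}`, `𝔮^h = (β)`, `T₀ = {q}`).
[cite: Cox2013, §7.B, §7.C Prop. 7.22, §7.D (7.27), Thm. 7.24] [cite: GrossLMS1991, §3 (p. 239)] [cite: Marcus2018, Ch. 3, Thm. 25] -/
theorem stub_splitPrimeKummerWitness (K : Type) [Field K] [NumberField K]
    (hK : Literature.NumberTheory.EllipticCurves.IsImaginaryQuadratic K) (hdK : NumberField.discr K < -4)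
    (p : ℕ) [Fact p.Prime] (hp3 : 3 ≤ p) (q : ℕ) [Fact q.Prime]
    (hq2 : ((Ideal.span {(q : ℤ)}).primesOver (NumberField.RingOfIntegers K)).ncard = 2) :
    Summit.BirchSwinnertonDyer.BirchSwinnertonDyer.Theorems.AuxNormReceptacle.SplitPrimeKummerWitness K p q :=
  fun E => Literature.NumberTheory.QuadraticFields.RingClass.exists_splitPrimeKummerWitness hK hdK Fact.out hp3
    Fact.out hq2 E

end Summit.BirchSwinnertonDyer.BirchSwinnertonDyer.Theorems.AuxNormReceptacle

end
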